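import Mathlib
import HarnessLib
import Literature.Analysis.PDE.DivFormStrongMaximumPrinciple
import Summits.NavierStokesRegularity.NavierStokesRegularity.Theorems.PoloidalWindowDoorPoloidalWindowRigidityDivFormReverseHolder
import Summits.NavierStokesRegularity.NavierStokesRegularity.Theorems.PoloidalWindowDoorPoloidalWindowRigidityDivFormLocalCaccioppoli

/-!
# Route `PoloidalWindowDoor`, crux K2 (stmt-NavierStokesRegularity-19708) — LOCAL energy estimates for the Moser test
# functions `χ w^{q/2}` of `div(a∇w) = 0` on an open set `U` (towards `divFormStrongMaximumPrinciple_holds`, GT 8.19)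

Local twin of `…DivFormReverseHolder` (seat ns-poloidal-K2-p3): the same two estimates, for a `C¹` function `w ≥ 1`
that solves `div(a∇w) = 0` weakly only against test functions with `tsupport η ⊆ U` (the hypothesis of
`Literature.Analysis.PDE.divFormStrongMaximumPrinciple` and of line stub C1 of `Cruxes/PoloidalWindowRigidity/Lines/
thread_type.lean`), the cutoff `χ` carrying `tsupport χ ⊆ U`:

* `gradPow_estimate_local` — `λ ∫ χ² ‖D(w^{q/2})‖² ≤ (q/(q−1))² nΛ ∫ w^q ‖Dχ‖²`, `q ∉ {0,1}` (Moser 1961 (4.5));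
* `energy_testPow_le_local` — for a two-radius cutoff of `B(x₀,ρ') ⊂ B(x₀,ρ)` with `‖Dχ‖ ≤ C₀/(ρ−ρ')`:
  `λ ∫ ‖D(χ w^{q/2})‖² ≤ 2((q/(q−1))² nΛ + λ)(C₀/(ρ−ρ'))² ∫_{B̄(x₀,ρ)} w^q`.

Proofs copied from the sibling with the hypothesis localised (one extra argument threaded); the calculus helpers
(`contDiff_rpow_of_one_le`, `norm_fderiv_rpow_half_sq`, `norm_fderiv_mul_sq_le`, …) are imported from it.  Seat
ns-in-ser-b g5 (cell pub/ns-inputs), `ledger fact claim` #1 on `Literature.Analysis.PDE.divFormStrongMaximumPrinciple`.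

WHAT THIS IS NOT: not yet the Moser step / Harnack / strong maximum principle (sequel files); nothing NS-specific, no NS
statement is touched.
-/

noncomputable section

open MeasureTheory Set Function Filter Topology Metric
open scoped Matrix ENNReal

-- the summit and its single sub-problem share the name (CONVENTIONS §1), as in every Theorems file
set_option linter.dupNamespace false

namespace Summit.NavierStokesRegularity.NavierStokesRegularity.Theorems.PoloidalWindowDoorPoloidalWindowRigidityDivFormLocalReverseHolder

open Summit.NavierStokesRegularity.NavierStokesRegularity.Theorems.PoloidalWindowDoorPoloidalWindowRigidityDivFormCaccioppoli
open Summit.NavierStokesRegularity.NavierStokesRegularity.Theorems.PoloidalWindowDoorPoloidalWindowRigidityDivFormCaccioppoliPowers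
open Summit.NavierStokesRegularity.NavierStokesRegularity.Theorems.PoloidalWindowDoorPoloidalWindowRigidityDivFormReverseHolder
open Summit.NavierStokesRegularity.NavierStokesRegularity.Theorems.PoloidalWindowDoorPoloidalWindowRigidityDivFormLocalCaccioppoli
open Literature.Analysis.FunctionSpaces

variable {n : ℕ} {w : EuclideanSpace ℝ (Fin n) → ℝ} {a : EuclideanSpace ℝ (Fin n) → Matrix (Fin n) (Fin n) ℝ}
  {lam Λ : ℝ} {U : Set (EuclideanSpace ℝ (Fin n))}

/-! ### The gradient of `w^{q/2}`: local energy estimate -/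

/-- **Energy estimate for powers** (Moser 1961 (4.5)): for an entire `C¹` weak solution `w ≥ 1`, `q ∉ {0,1}` and
`χ ∈ C¹_c`: `λ ∫ χ² ‖D(w^{q/2})‖² ≤ (q/(q−1))² · nΛ · ∫ w^q ‖Dχ‖²`. -/
theorem gradPow_estimate_local (hsymm : ∀ y, (a y).IsSymm) (hlam : 0 < lam)
    (hmeas : ∀ i j, Measurable fun y => a y i j)
    (hell : ∀ y (ξ : Fin n → ℝ), lam * (ξ ⬝ᵥ ξ) ≤ ξ ⬝ᵥ (a y *ᵥ ξ)) (hbd : ∀ y i j, |a y i j| ≤ Λ)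
    (hw : ContDiff ℝ 1 w) (hw1 : ∀ y, 1 ≤ w y)
    (hweak : ∀ η : EuclideanSpace ℝ (Fin n) → ℝ, ContDiff ℝ 1 η → HasCompactSupport η → tsupport η ⊆ U →
      ∫ y, ∑ i, ∑ j, a y i j * fderiv ℝ w y (EuclideanSpace.single i 1) *
        fderiv ℝ η y (EuclideanSpace.single j 1) = 0)
    {q : ℝ} (hq0 : q ≠ 0) (hq1 : q ≠ 1)
    {χ : EuclideanSpace ℝ (Fin n) → ℝ} (hχ : ContDiff ℝ 1 χ) (hχc : HasCompactSupport χ)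
    (hχU : tsupport χ ⊆ U) :
    lam * ∫ y, χ y ^ 2 * ‖fderiv ℝ (fun y => w y ^ (q / 2)) y‖ ^ 2 ≤
      (q / (q - 1)) ^ 2 * (n * Λ) * ∫ y, w y ^ q * ‖fderiv ℝ χ y‖ ^ 2 := by
  have hpos : ∀ y, 0 < w y := fun y => lt_of_lt_of_le one_pos (hw1 y)
  have hβ : q - 1 ≠ 0 := sub_ne_zero.2 hq1
  have hC := caccioppoli_rpow_local hsymm hlam hmeas hell hbd hw hw1 hweak hβ hχ hχc hχU
  simp only [sub_add_cancel] at hC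
  have hcw := continuous_fderiv_single hw
  have hcχ := continuous_fderiv_single hχ
  -- continuity of the weights
  have hwq : ∀ s : ℝ, Continuous fun y => w y ^ s := fun s => (contDiff_rpow_of_one_le hw hw1 s).continuous
  have hnw : Continuous fun y => ‖fderiv ℝ w y‖ ^ 2 := ((hw.continuous_fderiv one_ne_zero).norm).pow 2
  have hnχ : Continuous fun y => ‖fderiv ℝ χ y‖ ^ 2 := ((hχ.continuous_fderiv one_ne_zero).norm).pow 2
  -- (1) left side: `λ χ² ‖D(w^{q/2})‖² = (q/2)² χ² w^{q−2} · λ‖Dw‖² ≤ (q/2)² χ² w^{(q−1)−1} Q(Dw)`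
  have hgC : ContDiff ℝ 1 fun y => w y ^ (q / 2) := contDiff_rpow_of_one_le hw hw1 (q / 2)
  have hng : Continuous fun y => ‖fderiv ℝ (fun y => w y ^ (q / 2)) y‖ ^ 2 :=
    ((hgC.continuous_fderiv one_ne_zero).norm).pow 2
  have hsuppχ2 : HasCompactSupport fun y => χ y ^ 2 := hχc.comp_left (g := fun s : ℝ => s ^ 2) (by simp)
  have hsuppL : HasCompactSupport fun y => χ y ^ 2 * ‖fderiv ℝ (fun y => w y ^ (q / 2)) y‖ ^ 2 :=
    hsuppχ2.mul_right (f' := fun y => ‖fderiv ℝ (fun y => w y ^ (q / 2)) y‖ ^ 2)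
  have hL_int : Integrable fun y => χ y ^ 2 * ‖fderiv ℝ (fun y => w y ^ (q / 2)) y‖ ^ 2 :=
    ((hχ.continuous.pow 2).mul hng).integrable_of_hasCompactSupport hsuppL
  have hQ_int : Integrable fun y => χ y ^ 2 * w y ^ (q - 1 - 1) *
      ((fun i => fderiv ℝ w y (EuclideanSpace.single i 1)) ⬝ᵥ
        (a y *ᵥ fun i => fderiv ℝ w y (EuclideanSpace.single i 1))) := by
    have h' := integrable_mul_of_le_continuous (n := n)
      (m := fun y => (fun i => fderiv ℝ w y (EuclideanSpace.single i 1)) ⬝ᵥ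
        (a y *ᵥ fun i => fderiv ℝ w y (EuclideanSpace.single i 1)))
      (M := fun y => n * Λ * (∑ i, fderiv ℝ w y (EuclideanSpace.single i 1) ^ 2 +
        ∑ j, fderiv ℝ w y (EuclideanSpace.single j 1) ^ 2) / 2)
      (φ := fun y => χ y ^ 2 * w y ^ (q - 1 - 1))
      (measurable_dotProduct_mulVec hmeas hcw hcw) (by fun_prop)
      (fun y => abs_dotProduct_mulVec_le hsymm hlam hell hbd y _ _) ((hχ.continuous.pow 2).mul (hwq _))
      (hasCompactSupport_testFun (u := w) (g := fun s => s ^ (q - 1 - 1)) hχc)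
    exact h'.congr (Eventually.of_forall fun y => by ring)
  have hL : lam * ∫ y, χ y ^ 2 * ‖fderiv ℝ (fun y => w y ^ (q / 2)) y‖ ^ 2 ≤
      (q / 2) ^ 2 * ∫ y, χ y ^ 2 * w y ^ (q - 1 - 1) *
        ((fun i => fderiv ℝ w y (EuclideanSpace.single i 1)) ⬝ᵥ
          (a y *ᵥ fun i => fderiv ℝ w y (EuclideanSpace.single i 1))) := by
    rw [← integral_const_mul, ← integral_const_mul]
    refine integral_mono (hL_int.const_mul lam) (hQ_int.const_mul _) fun y => ?_
    have hq := quadForm_lower hell y (fun i => fderiv ℝ w y (EuclideanSpace.single i 1))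
    rw [sum_fderiv_single_sq] at hq
    rw [norm_fderiv_rpow_half_sq hw hw1 q y, show q - 1 - 1 = q - 2 by ring]
    have hw0 : 0 ≤ χ y ^ 2 * w y ^ (q - 2) * (q / 2) ^ 2 :=
      mul_nonneg (mul_nonneg (sq_nonneg _) (Real.rpow_nonneg (hpos y).le _)) (sq_nonneg _)
    have hm := mul_le_mul_of_nonneg_left hq hw0
    calc lam * (χ y ^ 2 * ((q / 2) ^ 2 * w y ^ (q - 2) * ‖fderiv ℝ w y‖ ^ 2))
        = χ y ^ 2 * w y ^ (q - 2) * (q / 2) ^ 2 * (lam * ‖fderiv ℝ w y‖ ^ 2) := by ring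
      _ ≤ χ y ^ 2 * w y ^ (q - 2) * (q / 2) ^ 2 *
          ((fun i => fderiv ℝ w y (EuclideanSpace.single i 1)) ⬝ᵥ
            (a y *ᵥ fun i => fderiv ℝ w y (EuclideanSpace.single i 1))) := hm
      _ = (q / 2) ^ 2 * (χ y ^ 2 * w y ^ (q - 2) *
          ((fun i => fderiv ℝ w y (EuclideanSpace.single i 1)) ⬝ᵥ
            (a y *ᵥ fun i => fderiv ℝ w y (EuclideanSpace.single i 1)))) := by ring
  -- (2) right side: `Q(Dχ) ≤ nΛ ‖Dχ‖²`
  have hR_int : Integrable fun y => w y ^ q * ‖fderiv ℝ χ y‖ ^ 2 := by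
    refine ((hwq q).mul hnχ).integrable_of_hasCompactSupport ?_
    exact ((hχc.fderiv (𝕜 := ℝ)).norm.comp_left (g := fun s : ℝ => s ^ 2) (by simp)).mul_left
  have hRq_int : Integrable fun y => w y ^ q *
      ((fun j => fderiv ℝ χ y (EuclideanSpace.single j 1)) ⬝ᵥ
        (a y *ᵥ fun j => fderiv ℝ χ y (EuclideanSpace.single j 1))) := by
    refine (hR_int.const_mul (n * Λ)).mono'
      ((hwq q).aestronglyMeasurable.mul (measurable_dotProduct_mulVec hmeas hcχ hcχ).aestronglyMeasurable)
      (Eventually.of_forall fun y => ?_)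
    have hq0' : 0 ≤ ((fun j => fderiv ℝ χ y (EuclideanSpace.single j 1)) ⬝ᵥ
        (a y *ᵥ fun j => fderiv ℝ χ y (EuclideanSpace.single j 1))) :=
      (mul_nonneg hlam.le (Finset.sum_nonneg fun i _ => sq_nonneg _)).trans (quadForm_lower hell y _)
    have hup := quadForm_upper hbd y (fun j => fderiv ℝ χ y (EuclideanSpace.single j 1))
    rw [sum_fderiv_single_sq] at hup
    rw [Real.norm_eq_abs, abs_of_nonneg (mul_nonneg (Real.rpow_nonneg (hpos y).le _) hq0')]
    calc w y ^ q * ((fun j => fderiv ℝ χ y (EuclideanSpace.single j 1)) ⬝ᵥ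
          (a y *ᵥ fun j => fderiv ℝ χ y (EuclideanSpace.single j 1)))
        ≤ w y ^ q * (n * Λ * ‖fderiv ℝ χ y‖ ^ 2) := mul_le_mul_of_nonneg_left hup (Real.rpow_nonneg (hpos y).le _)
      _ = n * Λ * (w y ^ q * ‖fderiv ℝ χ y‖ ^ 2) := by ring
  have hR : ∫ y, w y ^ q * ((fun j => fderiv ℝ χ y (EuclideanSpace.single j 1)) ⬝ᵥ
        (a y *ᵥ fun j => fderiv ℝ χ y (EuclideanSpace.single j 1))) ≤
      n * Λ * ∫ y, w y ^ q * ‖fderiv ℝ χ y‖ ^ 2 := by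
    rw [← integral_const_mul]
    refine integral_mono hRq_int (hR_int.const_mul _) fun y => ?_
    have hup := quadForm_upper hbd y (fun j => fderiv ℝ χ y (EuclideanSpace.single j 1))
    rw [sum_fderiv_single_sq] at hup
    calc w y ^ q * ((fun j => fderiv ℝ χ y (EuclideanSpace.single j 1)) ⬝ᵥ
          (a y *ᵥ fun j => fderiv ℝ χ y (EuclideanSpace.single j 1)))
        ≤ w y ^ q * (n * Λ * ‖fderiv ℝ χ y‖ ^ 2) := mul_le_mul_of_nonneg_left hup (Real.rpow_nonneg (hpos y).le _)
      _ = n * Λ * (w y ^ q * ‖fderiv ℝ χ y‖ ^ 2) := by ring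
  -- assemble: `λ∫χ²‖Dg‖² ≤ (q/2)² · (4/(q−1)²) ∫ w^q Q(Dχ) ≤ (q/(q−1))² nΛ ∫ w^q ‖Dχ‖²`
  have hq2 : 0 ≤ (q / 2) ^ 2 := sq_nonneg _
  calc lam * ∫ y, χ y ^ 2 * ‖fderiv ℝ (fun y => w y ^ (q / 2)) y‖ ^ 2
      ≤ (q / 2) ^ 2 * ∫ y, χ y ^ 2 * w y ^ (q - 1 - 1) *
          ((fun i => fderiv ℝ w y (EuclideanSpace.single i 1)) ⬝ᵥ
            (a y *ᵥ fun i => fderiv ℝ w y (EuclideanSpace.single i 1))) := hL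
    _ ≤ (q / 2) ^ 2 * (4 / (q - 1) ^ 2 * ∫ y, w y ^ q *
          ((fun j => fderiv ℝ χ y (EuclideanSpace.single j 1)) ⬝ᵥ
            (a y *ᵥ fun j => fderiv ℝ χ y (EuclideanSpace.single j 1)))) :=
        mul_le_mul_of_nonneg_left hC hq2
    _ ≤ (q / 2) ^ 2 * (4 / (q - 1) ^ 2 * (n * Λ * ∫ y, w y ^ q * ‖fderiv ℝ χ y‖ ^ 2)) :=
        mul_le_mul_of_nonneg_left (mul_le_mul_of_nonneg_left hR (by positivity)) hq2
    _ = (q / (q - 1)) ^ 2 * (n * Λ) * ∫ y, w y ^ q * ‖fderiv ℝ χ y‖ ^ 2 := by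
        field_simp
        ring



/-- **Energy of the Moser test function.**  For an entire `C¹` weak solution `w ≥ 1`, `q ∉ {0,1}`, and a two-radius cutoff
`χ` of `B(x₀,ρ') ⊂ B(x₀,ρ)` with `‖Dχ‖ ≤ C₀/(ρ−ρ')` and `χ = 0` off `B(x₀,ρ)`:
`λ ∫ ‖D(χ w^{q/2})‖² ≤ 2 ((q/(q−1))² nΛ + λ) (C₀/(ρ−ρ'))² ∫_{B̄(x₀,ρ)} w^q`. -/
theorem energy_testPow_le_local (hsymm : ∀ y, (a y).IsSymm) (hlam : 0 < lam)
    (hmeas : ∀ i j, Measurable fun y => a y i j)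
    (hell : ∀ y (ξ : Fin n → ℝ), lam * (ξ ⬝ᵥ ξ) ≤ ξ ⬝ᵥ (a y *ᵥ ξ)) (hbd : ∀ y i j, |a y i j| ≤ Λ)
    (hw : ContDiff ℝ 1 w) (hw1 : ∀ y, 1 ≤ w y)
    (hweak : ∀ η : EuclideanSpace ℝ (Fin n) → ℝ, ContDiff ℝ 1 η → HasCompactSupport η → tsupport η ⊆ U →
      ∫ y, ∑ i, ∑ j, a y i j * fderiv ℝ w y (EuclideanSpace.single i 1) *
        fderiv ℝ η y (EuclideanSpace.single j 1) = 0)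
    {q : ℝ} (hq0 : q ≠ 0) (hq1 : q ≠ 1) {x₀ : EuclideanSpace ℝ (Fin n)} {ρ' ρ C₀ : ℝ}
    {χ : EuclideanSpace ℝ (Fin n) → ℝ} (hχ : ContDiff ℝ 1 χ) (hχc : HasCompactSupport χ) (hχU : tsupport χ ⊆ U)
    (hχ0 : ∀ x, x ∉ ball x₀ ρ → χ x = 0) (hχD : ∀ x, ‖fderiv ℝ χ x‖ ≤ C₀ / (ρ - ρ')) :
    lam * ∫ y, ‖fderiv ℝ (fun y => χ y * w y ^ (q / 2)) y‖ ^ 2 ≤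
      2 * ((q / (q - 1)) ^ 2 * (n * Λ) + lam) * (C₀ / (ρ - ρ')) ^ 2 * ∫ y in closedBall x₀ ρ, w y ^ q := by
  have hpos : ∀ y, 0 < w y := fun y => lt_of_lt_of_le one_pos (hw1 y)
  have hG := gradPow_estimate_local hsymm hlam hmeas hell hbd hw hw1 hweak hq0 hq1 hχ hχc hχU
  have hgC : ContDiff ℝ 1 fun y => w y ^ (q / 2) := contDiff_rpow_of_one_le hw hw1 (q / 2)
  have hwq : ∀ s : ℝ, Continuous fun y => w y ^ s := fun s => (contDiff_rpow_of_one_le hw hw1 s).continuous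
  have hng : Continuous fun y => ‖fderiv ℝ (fun y => w y ^ (q / 2)) y‖ ^ 2 :=
    ((hgC.continuous_fderiv one_ne_zero).norm).pow 2
  have hnχ : Continuous fun y => ‖fderiv ℝ χ y‖ ^ 2 := ((hχ.continuous_fderiv one_ne_zero).norm).pow 2
  have hg2 : ∀ y, (w y ^ (q / 2)) ^ 2 = w y ^ q := fun y => by
    rw [← Real.rpow_natCast, ← Real.rpow_mul (hpos y).le]; congr 1; push_cast; ring
  -- compact supports
  have hsuppχ2 : HasCompactSupport fun y => χ y ^ 2 := hχc.comp_left (g := fun s : ℝ => s ^ 2) (by simp)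
  have hsuppDχ : HasCompactSupport fun y => ‖fderiv ℝ χ y‖ ^ 2 :=
    (hχc.fderiv (𝕜 := ℝ)).norm.comp_left (g := fun s : ℝ => s ^ 2) (by simp)
  have hsuppφ : HasCompactSupport fun y => χ y * w y ^ (q / 2) := hχc.mul_right (f' := fun y => w y ^ (q / 2))
  -- integrability
  have hI1 : Integrable fun y => χ y ^ 2 * ‖fderiv ℝ (fun y => w y ^ (q / 2)) y‖ ^ 2 :=
    ((hχ.continuous.pow 2).mul hng).integrable_of_hasCompactSupport
      (hsuppχ2.mul_right (f' := fun y => ‖fderiv ℝ (fun y => w y ^ (q / 2)) y‖ ^ 2))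
  have hI2 : Integrable fun y => w y ^ q * ‖fderiv ℝ χ y‖ ^ 2 :=
    ((hwq q).mul hnχ).integrable_of_hasCompactSupport (hsuppDχ.mul_left (f := fun y => w y ^ q))
  have hφC : ContDiff ℝ 1 fun y => χ y * w y ^ (q / 2) := hχ.mul hgC
  have hnφ : Continuous fun y => ‖fderiv ℝ (fun y => χ y * w y ^ (q / 2)) y‖ ^ 2 :=
    ((hφC.continuous_fderiv one_ne_zero).norm).pow 2
  have hsuppDφ0 : HasCompactSupport (fderiv ℝ fun y => χ y * w y ^ (q / 2)) := hsuppφ.fderiv (𝕜 := ℝ)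
  have hsuppDφ : HasCompactSupport fun y => ‖fderiv ℝ (fun y => χ y * w y ^ (q / 2)) y‖ ^ 2 := by
    refine hsuppDφ0.norm.mono (Function.support_subset_iff'.2 fun y hy => ?_)
    simp only [Function.mem_support, not_not] at hy
    simp [hy]
  have hIφ : Integrable fun y => ‖fderiv ℝ (fun y => χ y * w y ^ (q / 2)) y‖ ^ 2 :=
    hnφ.integrable_of_hasCompactSupport hsuppDφ
  -- (1) `∫ ‖Dφ‖² ≤ 2 ∫ χ²‖Dg‖² + 2 ∫ w^q ‖Dχ‖²`
  have h1 : ∫ y, ‖fderiv ℝ (fun y => χ y * w y ^ (q / 2)) y‖ ^ 2 ≤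
      2 * (∫ y, χ y ^ 2 * ‖fderiv ℝ (fun y => w y ^ (q / 2)) y‖ ^ 2) + 2 * (∫ y, w y ^ q * ‖fderiv ℝ χ y‖ ^ 2) := by
    rw [← integral_const_mul, ← integral_const_mul, ← integral_add (hI1.const_mul 2) (hI2.const_mul 2)]
    refine integral_mono hIφ ((hI1.const_mul 2).add (hI2.const_mul 2)) fun y => ?_
    have h := norm_fderiv_mul_sq_le hχ hgC y
    rw [hg2 y] at h
    simp only
    linarith
  -- (2) `∫ w^q ‖Dχ‖² ≤ (C₀/(ρ−ρ'))² ∫_{B̄(x₀,ρ)} w^q`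
  have hDχ_out : ∀ x, x ∉ closedBall x₀ ρ → fderiv ℝ χ x = 0 := by
    intro x hx
    have hev : χ =ᶠ[𝓝 x] fun _ => 0 := by
      filter_upwards [isClosed_closedBall.isOpen_compl.mem_nhds hx] with z hz
      exact hχ0 z fun hz' => hz (ball_subset_closedBall hz')
    rw [hev.fderiv_eq, fderiv_const_apply]
  have h2 : ∫ y, w y ^ q * ‖fderiv ℝ χ y‖ ^ 2 ≤ (C₀ / (ρ - ρ')) ^ 2 * ∫ y in closedBall x₀ ρ, w y ^ q := by
    have heq : ∫ y, w y ^ q * ‖fderiv ℝ χ y‖ ^ 2 = ∫ y in closedBall x₀ ρ, w y ^ q * ‖fderiv ℝ χ y‖ ^ 2 := by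
      refine (setIntegral_eq_integral_of_forall_compl_eq_zero fun y hy => ?_).symm
      rw [hDχ_out y hy, norm_zero, zero_pow two_ne_zero, mul_zero]
    rw [heq, ← integral_const_mul]
    have hIw : IntegrableOn (fun y => w y ^ q) (closedBall x₀ ρ) :=
      (hwq q).continuousOn.integrableOn_compact (isCompact_closedBall _ _)
    refine setIntegral_mono_on hI2.integrableOn (hIw.const_mul _) measurableSet_closedBall fun y _ => ?_
    have hwq0 : 0 ≤ w y ^ q := Real.rpow_nonneg (hpos y).le _
    calc w y ^ q * ‖fderiv ℝ χ y‖ ^ 2 ≤ w y ^ q * (C₀ / (ρ - ρ')) ^ 2 :=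
          mul_le_mul_of_nonneg_left (pow_le_pow_left₀ (norm_nonneg _) (hχD y) 2) hwq0
      _ = (C₀ / (ρ - ρ')) ^ 2 * w y ^ q := mul_comm _ _
  -- assemble
  have hI0 : 0 ≤ ∫ y in closedBall x₀ ρ, w y ^ q :=
    setIntegral_nonneg measurableSet_closedBall fun y _ => Real.rpow_nonneg (hpos y).le _
  have hnΛq : 0 ≤ (q / (q - 1)) ^ 2 * (n * Λ) := by
    rcases Nat.eq_zero_or_pos n with hn | hn
    · simp [hn]
    · exact mul_nonneg (sq_nonneg _) (mul_nonneg (Nat.cast_nonneg n) ((abs_nonneg _).trans (hbd x₀ ⟨0, hn⟩ ⟨0, hn⟩)))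
  calc lam * ∫ y, ‖fderiv ℝ (fun y => χ y * w y ^ (q / 2)) y‖ ^ 2
      ≤ lam * (2 * (∫ y, χ y ^ 2 * ‖fderiv ℝ (fun y => w y ^ (q / 2)) y‖ ^ 2) +
          2 * (∫ y, w y ^ q * ‖fderiv ℝ χ y‖ ^ 2)) := mul_le_mul_of_nonneg_left h1 hlam.le
    _ = 2 * (lam * ∫ y, χ y ^ 2 * ‖fderiv ℝ (fun y => w y ^ (q / 2)) y‖ ^ 2) +
          2 * lam * (∫ y, w y ^ q * ‖fderiv ℝ χ y‖ ^ 2) := by ring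
    _ ≤ 2 * ((q / (q - 1)) ^ 2 * (n * Λ) * ∫ y, w y ^ q * ‖fderiv ℝ χ y‖ ^ 2) +
          2 * lam * (∫ y, w y ^ q * ‖fderiv ℝ χ y‖ ^ 2) := by
        have := mul_le_mul_of_nonneg_left hG (by norm_num : (0 : ℝ) ≤ 2)
        linarith
    _ = 2 * ((q / (q - 1)) ^ 2 * (n * Λ) + lam) * ∫ y, w y ^ q * ‖fderiv ℝ χ y‖ ^ 2 := by ring
    _ ≤ 2 * ((q / (q - 1)) ^ 2 * (n * Λ) + lam) * ((C₀ / (ρ - ρ')) ^ 2 * ∫ y in closedBall x₀ ρ, w y ^ q) :=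
        mul_le_mul_of_nonneg_left h2 (by positivity)
    _ = 2 * ((q / (q - 1)) ^ 2 * (n * Λ) + lam) * (C₀ / (ρ - ρ')) ^ 2 * ∫ y in closedBall x₀ ρ, w y ^ q := by
        ring


end Summit.NavierStokesRegularity.NavierStokesRegularity.Theorems.PoloidalWindowDoorPoloidalWindowRigidityDivFormLocalReverseHolder

end
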